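import Summits.KontsevichZagierPeriods.KontsevichZagierPeriods.Theorems.TerasomaMultiplicationCompleteModGammaSectorElliottToCusp
import Literature.NumberTheory.Transcendental.KZCalculusProofs
import Literature.NumberTheory.Transcendental.KZLogCalculusProofs
import Literature.NumberTheory.Transcendental.KZDominatedFamilyRelations
import Literature.NumberTheory.Transcendental.KZBetaChains
import Literature.NumberTheory.Transcendental.KZCubeProducts
import Literature.NumberTheory.Transcendental.SemialgebraicRpow
import Literature.Analysis.SpecialFunctions.SelbergIntegralBasic

/-!
# Cusp transport, the `c = 1` row: the Elliott sector lands on the reflection Beta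
# (`CompleteModGammaSector`, stmt-KontsevichZagierPeriods-14233, line `cusp-transport-to-the-beta-world`)

Support file (`--supports stmt-KontsevichZagierPeriods-14233`) for the registered stub
`elliottRowOne_equivalent_reflectionBeta` of the line lead's skeleton.

**Statement.** Let `0 < a < 1` be rational and `z₁ ∈ (0,1)` a real algebraic modulus; write
`k(t;z) = t^{−a}(1−t)^{a−1}(1−zt)^{−a}` and `e(t;z) = k(t;z)(1−zt)` (the `c = 1` row of the Euler
kernels of `elliottToCusp`). Then every representation `r` pinned to the scaled Elliott–Legendre
2-cube `[(0,1)², (1−a)·(e(t;z₁)k(u;1−z₁) + k(t;z₁)e(u;1−z₁) − k(t;z₁)k(u;1−z₁))]` is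
`KZ.Equivalent` to every representation `β` pinned to the REFLECTION BETA
`[(0,1), t^{−a}(1−t)^{a−1}]` (value `B(1−a, a) = π / sin(πa)`). For `a = ½` this is Legendre's
relation `EK′ + KE′ − KK′ = π/2` in the form `[(0,1)², ½·(…)] ∼ [(0,1), t^{−1/2}(1−t)^{−1/2}]`.

**Proof (inside the printed rules of Kontsevich–Zagier 2001, §1.2).**
(1) The landed cusp transport `elliottToCusp_smul` at `c = 1`, `α = 1 − a` (algebraic, `a ∈ ℚ`)
makes `r` equivalent to the scaled cusp cube `ρ = [(0,1)², (1−a)·t^{−a}(1−t)^{a−1}·u^{−a}]`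
(`(1:ℚ) + a − 2 = a − 1`, `(1−u)^{(1:ℚ)−1} = 1`).
(2) `ρ ∼ β` by integrating out the last coordinate `u` (value identity `∫₀¹ (1−a)u^{−a} du = 1`),
exactly as in the sibling stub `stub_integrateOutU`: with the BAND representation
`B = [(0,1) × [0,1], (1−a)t^{−a}(1−t)^{a−1}u^{−a}]` over the base `(0,1)` (constant bounds
`0 ≤ 1`) and the primitive `H(t,u) = t^{−a}(1−t)^{a−1}·u^{1−a}` — `ℚ`-semialgebraic on the band,
continuous in `u ∈ [0,1]` (`1 − a > 0`), `∂_u H =` the integrand of `B` on `(0,1)`,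
`H(t,1) − H(t,0) = t^{−a}(1−t)^{a−1}` (`0^{1−a} = 0`) — `[B] − [β]` is ONE Newton–Leibniz move
(`KZ.newtonLeibnizRel`); the band differs from the open square by the two null faces `u ∈ {0,1}`
(`KZ.IntegralRep.of_sub_of_restrict_mem_relations`), and `ρ` IS the open restriction of `B`.
Everything is proved; no `def`, no named fact.

References: M. Kontsevich, D. Zagier, *Periods* (2001), §1.2, rules (1), (3);
G. D. Anderson, S.-L. Qiu, M. K. Vamanamurthy, M. Vuorinen, *Generalized elliptic integrals and
modular equations*, Pacific J. Math. 192 (2000), Cor. 3.13 (5);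
G. E. Andrews, R. Askey, R. Roy, *Special Functions* (1999), §1.1 and Thm 3.2.8.
-/

noncomputable section

-- `Summit.KontsevichZagierPeriods.KontsevichZagierPeriods.…` is the tree's mandated layout (single-conjunct summit).
set_option linter.dupNamespace false

namespace Summit.KontsevichZagierPeriods.KontsevichZagierPeriods.CompleteModGammaSectorCuspLine

open MeasureTheory Set
open Literature.NumberTheory.Transcendental
open Literature.NumberTheory.Transcendental.KZ
open Literature.ModelTheory.ExponentialFields (IsSemialgebraic isSemialgebraic_setOf_eval_le)
open MvPolynomial (aeval X)

/-! ## Coordinates on `ℝ²` (a base point of `ℝ¹` with a last coordinate adjoined) -/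

/-- `(x, t)₀ = x₀` for `x ∈ ℝ¹`. [folklore] -/
private theorem bandSnoc_apply_zero (x : Fin 1 → ℝ) (t : ℝ) : (Fin.snoc x t : Fin 2 → ℝ) 0 = x 0 :=
  rfl

/-- `(x, t)₁ = t` for `x ∈ ℝ¹`. [folklore] -/
private theorem bandSnoc_apply_one (x : Fin 1 → ℝ) (t : ℝ) : (Fin.snoc x t : Fin 2 → ℝ) 1 = t := rfl

/-! ## The band `(0,1) × [0,1] ⊆ ℝ²` (Newton–Leibniz format over the base `(0,1) ⊆ ℝ¹`) -/

/-- Coordinates of a point of the band `(0,1) × [0,1]`. [folklore] -/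
private theorem mem_unitBand {z : Fin 2 → ℝ}
    (hz : z ∈ {z : Fin 2 → ℝ | Fin.init z ∈ {x : Fin 1 → ℝ | x 0 ∈ Set.Ioo (0:ℝ) 1} ∧
      (0:ℝ) ≤ z (Fin.last 1) ∧ z (Fin.last 1) ≤ 1}) :
    (0 < z 0 ∧ z 0 < 1) ∧ 0 ≤ z 1 ∧ z 1 ≤ 1 := hz

/-- The open unit square lies in the band `(0,1) × [0,1]`. [folklore] -/
private theorem cube_subset_unitBand :
    {x : Fin 2 → ℝ | ∀ i, x i ∈ Set.Ioo (0:ℝ) 1} ⊆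
      {z : Fin 2 → ℝ | Fin.init z ∈ {x : Fin 1 → ℝ | x 0 ∈ Set.Ioo (0:ℝ) 1} ∧
        (0:ℝ) ≤ z (Fin.last 1) ∧ z (Fin.last 1) ≤ 1} :=
  fun _ hz => ⟨hz 0, (hz 1).1.le, (hz 1).2.le⟩

/-- The band `(0,1) × [0,1] ⊆ ℝ²` is `ℚ`-semialgebraic (a cylinder cut by two polynomial
inequalities). [folklore] -/
private theorem isSemialgebraic_unitBand :
    IsSemialgebraic ℚ {z : Fin 2 → ℝ | Fin.init z ∈ {x : Fin 1 → ℝ | x 0 ∈ Set.Ioo (0:ℝ) 1} ∧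
      (0:ℝ) ≤ z (Fin.last 1) ∧ z (Fin.last 1) ≤ 1} := by
  have h1 : IsSemialgebraic ℚ
      {z : Fin (1 + 1) → ℝ | Fin.init z ∈ {x : Fin 1 → ℝ | x 0 ∈ Set.Ioo (0:ℝ) 1}} :=
    BallPeeling.isSemialgebraic_posIoo.setOf_init_mem
  have h2 := isSemialgebraic_setOf_eval_le (k := ℚ) (R := ℝ) (0 : MvPolynomial (Fin 2) ℚ)
    (X (Fin.last 1))
  have h3 := isSemialgebraic_setOf_eval_le (k := ℚ) (R := ℝ) (X (Fin.last 1) : MvPolynomial (Fin 2) ℚ) 1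
  simp only [map_zero, map_one, MvPolynomial.aeval_X] at h2 h3
  convert (h1.inter h2).inter h3 using 1
  ext z
  simp only [mem_setOf_eq, mem_inter_iff, and_assoc]

/-- The band `(0,1) × [0,1]` differs from the open unit square by the two null faces
`u ∈ {0, 1}`. [folklore] -/
private theorem volume_unitBand_diff_cube :
    volume ({z : Fin 2 → ℝ | Fin.init z ∈ {x : Fin 1 → ℝ | x 0 ∈ Set.Ioo (0:ℝ) 1} ∧
      (0:ℝ) ≤ z (Fin.last 1) ∧ z (Fin.last 1) ≤ 1} \ {x | ∀ i, x i ∈ Set.Ioo (0:ℝ) 1}) = 0 := by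
  refine measure_mono_null (fun z hz => ?_)
    (measure_union_null (volume_setOf_last_eq_zero (n := 1) 0)
      (volume_setOf_last_eq_zero (n := 1) 1))
  obtain ⟨hz, hnot⟩ := hz
  have hz' := mem_unitBand hz
  have hl : z (Fin.last 1) = z 1 := rfl
  simp only [mem_union, mem_setOf_eq, hl]
  by_contra h
  push Not at h
  apply hnot
  intro i
  fin_cases i
  · exact hz'.1
  · exact ⟨lt_of_le_of_ne hz'.2.1 (Ne.symm h.1), lt_of_le_of_ne hz'.2.2 h.2⟩

/-- A function integrable on the open unit square is integrable on the band `(0,1) × [0,1]`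
(the difference is null). [folklore] -/
private theorem integrableOn_unitBand_of_cube {f : (Fin 2 → ℝ) → ℝ}
    (hf : IntegrableOn f {x : Fin 2 → ℝ | ∀ i, x i ∈ Set.Ioo (0:ℝ) 1}) :
    IntegrableOn f {z : Fin 2 → ℝ | Fin.init z ∈ {x : Fin 1 → ℝ | x 0 ∈ Set.Ioo (0:ℝ) 1} ∧
      (0:ℝ) ≤ z (Fin.last 1) ∧ z (Fin.last 1) ≤ 1} := by
  have h := hf.union (IntegrableOn.of_measure_zero volume_unitBand_diff_cube)
  rwa [union_sdiff_cancel cube_subset_unitBand] at h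

/-! ## Semialgebraic integrands (rational powers of polynomial factors) -/

/-- Rational powers (exponent `r = e ∈ ℚ`) of positive `ℚ`-semialgebraic functions
(`IsSemialgebraicFunOn.rpow_ratCast`). [cite: BochnakCosteRoy1998, Prop. 2.2.6] -/
private theorem sa_rpow {s : Set (Fin 2 → ℝ)} (hs : IsSemialgebraic ℚ s) {g : (Fin 2 → ℝ) → ℝ}
    (hg : IsSemialgebraicFunOn ℚ s g) (hpos : ∀ z ∈ s, 0 < g z) (e : ℚ) {r : ℝ}
    (hr : (e : ℝ) = r) : IsSemialgebraicFunOn ℚ s (fun z => g z ^ r) := by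
  subst hr
  exact hg.rpow_ratCast hs hpos e

/-- Rational powers with non-zero exponent `r = e ∈ ℚ` of non-negative `ℚ`-semialgebraic
functions (`IsSemialgebraicFunOn.rpow_ratCast_of_nonneg`). [cite: BochnakCosteRoy1998, Prop. 2.2.6] -/
private theorem sa_rpow_nonneg {s : Set (Fin 2 → ℝ)} {g : (Fin 2 → ℝ) → ℝ}
    (hg : IsSemialgebraicFunOn ℚ s g) (hnn : ∀ z ∈ s, 0 ≤ g z) {e : ℚ} (he : e ≠ 0) {r : ℝ}
    (hr : (e : ℝ) = r) : IsSemialgebraicFunOn ℚ s (fun z => g z ^ r) := by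
  subst hr
  exact hg.rpow_ratCast_of_nonneg hnn he

/-- Products of `ℚ`-semialgebraic functions (lambda form of `IsSemialgebraicFunOn.mul_holds`).
[cite: BochnakCosteRoy1998, Prop. 2.2.6] -/
private theorem sa_mul {s : Set (Fin 2 → ℝ)} {f g : (Fin 2 → ℝ) → ℝ}
    (hf : IsSemialgebraicFunOn ℚ s f) (hg : IsSemialgebraicFunOn ℚ s g) :
    IsSemialgebraicFunOn ℚ s (fun z => f z * g z) :=
  (IsSemialgebraicFunOn.mul_holds hf hg).congr fun _ _ => rfl

/-- The reflection factor `t^{-a}(1-t)^{a-1}` (`t = z 0`, `a ∈ ℚ`) is `ℚ`-semialgebraic on the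
band. [cite: BochnakCosteRoy1998, Prop. 2.2.6] -/
private theorem sa_tFactor (a : ℚ) :
    IsSemialgebraicFunOn ℚ {z : Fin 2 → ℝ | Fin.init z ∈ {x : Fin 1 → ℝ | x 0 ∈ Set.Ioo (0:ℝ) 1} ∧
      (0:ℝ) ≤ z (Fin.last 1) ∧ z (Fin.last 1) ≤ 1}
      (fun z : Fin 2 → ℝ => (z 0) ^ (-(a : ℝ)) * (1 - z 0) ^ ((a : ℝ) - 1)) := by
  have hB := isSemialgebraic_unitBand
  refine sa_mul (sa_rpow hB ((isSemialgebraicFunOn_aeval hB (X 0)).congr fun z _ => by simp)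
    (fun z hz => (mem_unitBand hz).1.1) (-a) (Rat.cast_neg a))
    (sa_rpow hB ((isSemialgebraicFunOn_aeval hB (1 - X 0)).congr fun z _ => by simp)
    (fun z hz => by linarith [(mem_unitBand hz).1.2]) (a - 1) (by rw [Rat.cast_sub, Rat.cast_one]))

/-- The scaled cusp integrand `(1-a)·t^{-a}(1-t)^{a-1}u^{-a}` (`0 < a ∈ ℚ`) is `ℚ`-semialgebraic
on the band (on the face `u = 0` it takes Mathlib's value `0 ^ (-a) = 0`).
[cite: BochnakCosteRoy1998, Prop. 2.2.6] -/
private theorem sa_integrand (a : ℚ) (ha0 : 0 < a) :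
    IsSemialgebraicFunOn ℚ {z : Fin 2 → ℝ | Fin.init z ∈ {x : Fin 1 → ℝ | x 0 ∈ Set.Ioo (0:ℝ) 1} ∧
      (0:ℝ) ≤ z (Fin.last 1) ∧ z (Fin.last 1) ≤ 1}
      (fun x : Fin 2 → ℝ => (1 - (a : ℝ)) *
        ((x 0) ^ (-(a : ℝ)) * (1 - x 0) ^ ((a : ℝ) - 1) * (x 1) ^ (-(a : ℝ)))) := by
  have hB := isSemialgebraic_unitBand
  exact sa_mul ((isSemialgebraicFunOn_ratCast hB (1 - a)).congr fun z _ => by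
      rw [Rat.cast_sub, Rat.cast_one])
    (sa_mul (sa_tFactor a)
      (sa_rpow_nonneg ((isSemialgebraicFunOn_aeval hB (X 1)).congr fun z _ => by simp)
        (fun z hz => (mem_unitBand hz).2.1) (e := -a) (neg_ne_zero.mpr ha0.ne') (Rat.cast_neg a)))

/-- The primitive `H = t^{-a}(1-t)^{a-1} · u^{1-a}` (`a < 1` rational) is `ℚ`-semialgebraic on the
band. [cite: BochnakCosteRoy1998, Prop. 2.2.6] -/
private theorem sa_primitive (a : ℚ) (ha1 : a < 1) :
    IsSemialgebraicFunOn ℚ {z : Fin 2 → ℝ | Fin.init z ∈ {x : Fin 1 → ℝ | x 0 ∈ Set.Ioo (0:ℝ) 1} ∧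
      (0:ℝ) ≤ z (Fin.last 1) ∧ z (Fin.last 1) ≤ 1}
      (fun z : Fin 2 → ℝ => (z 0) ^ (-(a : ℝ)) * (1 - z 0) ^ ((a : ℝ) - 1) *
        (z 1) ^ (1 - (a : ℝ))) := by
  have hB := isSemialgebraic_unitBand
  exact sa_mul (sa_tFactor a)
    (sa_rpow_nonneg ((isSemialgebraicFunOn_aeval hB (X 1)).congr fun z _ => by simp)
      (fun z hz => (mem_unitBand hz).2.1) (e := 1 - a) (sub_ne_zero.mpr ha1.ne') (by
        rw [Rat.cast_sub, Rat.cast_one]))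

/-! ## The registered stub -/

/-- **Registered stub `elliottRowOne_equivalent_reflectionBeta`** (the `c = 1` row of the cusp
transport): for rational `0 < a < 1` and a real algebraic modulus `z₁ ∈ (0,1)`, every
representation `r` pinned to the scaled Elliott–Legendre 2-cube
`[(0,1)², (1−a)·(e(t;z₁)k(u;1−z₁) + k(t;z₁)e(u;1−z₁) − k(t;z₁)k(u;1−z₁))]`
(`k(t;z) = t^{−a}(1−t)^{a−1}(1−zt)^{−a}`, `e = k·(1−zt)`) is KZ-equivalent to every representation
`β` pinned to the reflection Beta `[(0,1), t^{−a}(1−t)^{a−1}]`. Chain: `elliottToCusp_smul` at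
`c = 1`, `α = 1 − a` lands `r` on the scaled cusp cube `[(0,1)², (1−a)t^{−a}(1−t)^{a−1}u^{−a}]`;
then ONE Newton–Leibniz move along `u` over the base `(0,1)` (band `(0,1) × [0,1]`, bounds
`0 ≤ 1`, primitive `H = t^{−a}(1−t)^{a−1}u^{1−a}`, `∂_u H =` the cusp integrand,
`H(t,1) − H(t,0) = t^{−a}(1−t)^{a−1}`) and the two null faces `u ∈ {0,1}` dropped by domain
additivity. Value identity `∫₀¹ (1−a)u^{−a} du = 1`; for `a = ½`, Legendre's relation
`EK′ + KE′ − KK′ = π/2`. [cite: KontsevichZagier2001, §1.2 rule (3)] -/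
theorem elliottRowOne_equivalent_reflectionBeta : ∀ (a : ℚ) (z₁ : ℝ), 0 < a → a < 1 → 0 < z₁ → z₁ < 1 → IsAlgebraic ℚ z₁ → ∀ (r : IntegralRep 2) (β : IntegralRep 1), r.domain = {x | ∀ i, x i ∈ Set.Ioo (0:ℝ) 1} → Set.EqOn r.integrand (fun x => (1 - (a : ℝ)) * ((x 0) ^ (-(a : ℝ)) * (1 - x 0) ^ ((a : ℝ) - 1) * (1 - z₁ * x 0) ^ (1 - (a : ℝ)) * ((x 1) ^ (-(a : ℝ)) * (1 - x 1) ^ ((a : ℝ) - 1) * (1 - (1 - z₁) * x 1) ^ (-(a : ℝ))) + (x 0) ^ (-(a : ℝ)) * (1 - x 0) ^ ((a : ℝ) - 1) * (1 - z₁ * x 0) ^ (-(a : ℝ)) * ((x 1) ^ (-(a : ℝ)) * (1 - x 1) ^ ((a : ℝ) - 1) * (1 - (1 - z₁) * x 1) ^ (1 - (a : ℝ))) - (x 0) ^ (-(a : ℝ)) * (1 - x 0) ^ ((a : ℝ) - 1) * (1 - z₁ * x 0) ^ (-(a : ℝ)) * ((x 1) ^ (-(a : ℝ)) * (1 - x 1)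 ^ ((a : ℝ) - 1) * (1 - (1 - z₁) * x 1) ^ (-(a : ℝ))))) r.domain → β.domain = {x | x 0 ∈ Set.Ioo (0:ℝ) 1} → Set.EqOn β.integrand (fun x => (x 0) ^ (-(a : ℝ)) * (1 - x 0) ^ ((a : ℝ) - 1)) β.domain → Equivalent r β := by
  intro a z₁ ha0 ha1 hz0 hz1 hzalg r β hrd hri hβd hβi
  have h1a : (0:ℝ) < 1 - (a : ℝ) := by
    have h : (a : ℝ) < 1 := by exact_mod_cast ha1
    linarith
  have halg : IsAlgebraic ℚ (1 - (a : ℝ)) := by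
    have h : IsAlgebraic ℚ (((1 - a : ℚ)) : ℝ) := isAlgebraic_algebraMap _
    rwa [Rat.cast_sub, Rat.cast_one] at h
  -- (a) the scaled cusp integrand is integrable on the open square (a product of Beta kernels)
  have hIcube : IntegrableOn (fun x : Fin 2 → ℝ => (1 - (a : ℝ)) *
      ((x 0) ^ (-(a : ℝ)) * (1 - x 0) ^ ((a : ℝ) - 1) * (x 1) ^ (-(a : ℝ))))
      {x : Fin 2 → ℝ | ∀ i, x i ∈ Set.Ioo (0:ℝ) 1} := by
    have h := integrableOn_cubeBetaIntegrand ![1 - a, 1 - a] ![a, 1] (by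
      rw [Fin.forall_fin_two]
      simp only [Matrix.cons_val_zero, Matrix.cons_val_one]
      exact ⟨⟨by linarith, ha0⟩, by linarith, one_pos⟩)
    refine (h.congr_fun (fun x _ => ?_) (measurableSet_setOf_forall_apply_mem_Ioo 2)).const_mul
      (1 - (a : ℝ))
    simp only [Fin.prod_univ_two, Matrix.cons_val_zero, Matrix.cons_val_one, Rat.cast_sub,
      Rat.cast_one, sub_sub_cancel_left, sub_self, Real.rpow_zero, mul_one]
  -- (b) the band representation `B = [(0,1) × [0,1], (1-a) t^{-a}(1-t)^{a-1} u^{-a}]`;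
  --     its open restriction to `(0,1)²` is the scaled cusp cube `ρ`
  obtain ⟨B, hBd, hBi⟩ : ∃ B : IntegralRep 2,
      B.domain = {z : Fin 2 → ℝ | Fin.init z ∈ {x : Fin 1 → ℝ | x 0 ∈ Set.Ioo (0:ℝ) 1} ∧
        (0:ℝ) ≤ z (Fin.last 1) ∧ z (Fin.last 1) ≤ 1} ∧
      B.integrand = fun x : Fin 2 → ℝ => (1 - (a : ℝ)) *
        ((x 0) ^ (-(a : ℝ)) * (1 - x 0) ^ ((a : ℝ) - 1) * (x 1) ^ (-(a : ℝ))) :=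
    ⟨⟨_, _, isSemialgebraic_unitBand, sa_integrand a ha0, integrableOn_unitBand_of_cube hIcube⟩,
      rfl, rfl⟩
  have hsub : {x : Fin 2 → ℝ | ∀ i, x i ∈ Set.Ioo (0:ℝ) 1} ⊆ B.domain := by
    rw [hBd]
    exact cube_subset_unitBand
  -- (c) `r ∼ ρ`: the `c = 1` row of the cusp transport `elliottToCusp_smul`, `α = 1 - a`
  have hc2 : ((1:ℚ) : ℝ) + (a : ℝ) - 2 = (a : ℝ) - 1 := by
    rw [Rat.cast_one]
    ring
  have hc1 : ((1:ℚ) : ℝ) - 1 = 0 := by rw [Rat.cast_one, sub_self]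
  have hrρ : Equivalent r (B.restrict _ (isSemialgebraic_box 2) hsub) := by
    refine elliottToCusp_smul a 1 z₁ (1 - (a : ℝ)) ha0 ha1 (by linarith) hz0 hz1 hzalg halg r
      (B.restrict _ (isSemialgebraic_box 2) hsub) hrd (fun x hx => ?_) rfl (fun x _ => ?_)
    · rw [hri hx]
      simp only [hc2]
    · rw [IntegralRep.integrand_restrict, hBi]
      simp only [hc2, hc1, Real.rpow_zero, mul_one]
  -- (d) ONE Newton–Leibniz move along `u`: `[B] − [β] ∈ newtonLeibnizRel`
  have hNL : of B - of β ∈ newtonLeibnizRel := by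
    refine ⟨1, B, β, fun _ => (0:ℝ), fun _ => (1:ℝ),
      fun z : Fin 2 → ℝ => (z 0) ^ (-(a : ℝ)) * (1 - z 0) ^ ((a : ℝ) - 1) * (z 1) ^ (1 - (a : ℝ)),
      ?_, ?_, ?_, fun _ _ => zero_le_one, ?_, ?_, ?_, ?_, rfl⟩
    · rw [hBd]
      exact sa_primitive a ha1
    · exact (isSemialgebraicFunOn_natCast β.isSemialgebraic_domain 0).congr fun _ _ => by simp
    · exact (isSemialgebraicFunOn_natCast β.isSemialgebraic_domain 1).congr fun _ _ => by simp
    · rw [hBd, hβd]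
    · intro x _
      simp only [bandSnoc_apply_zero, bandSnoc_apply_one]
      exact continuousOn_const.mul (continuousOn_id.rpow_const fun t _ => Or.inr h1a.le)
    · intro x _ t ht
      have ht' : t ∈ Set.Ioo (0:ℝ) 1 := ht
      simp only [hBi, bandSnoc_apply_zero, bandSnoc_apply_one]
      have h := (Real.hasDerivAt_rpow_const (p := 1 - (a : ℝ)) (Or.inl ht'.1.ne')).const_mul
        ((x 0) ^ (-(a : ℝ)) * (1 - x 0) ^ ((a : ℝ) - 1))
      refine h.congr_deriv ?_
      rw [show (1 - (a : ℝ)) - 1 = -(a : ℝ) by ring]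
      ring
    · intro x hx
      simp only [bandSnoc_apply_zero, bandSnoc_apply_one, Real.one_rpow,
        Real.zero_rpow h1a.ne', mul_zero, sub_zero, mul_one]
      exact hβi hx
  -- (e) drop the null faces `u ∈ {0, 1}` (domain additivity) and compose
  have h1 : of B - of β ∈ relations := newtonLeibnizRel_subset_relations hNL
  have h2 : of B - of (B.restrict _ (isSemialgebraic_box 2) hsub) ∈ relations :=
    B.of_sub_of_restrict_mem_relations (isSemialgebraic_box 2) hsub (by
      rw [hBd]
      exact volume_unitBand_diff_cube)
  have hρβ : Equivalent (B.restrict _ (isSemialgebraic_box 2) hsub) β := by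
    have hsum : of (B.restrict _ (isSemialgebraic_box 2) hsub) - of β =
        (of B - of β) - (of B - of (B.restrict _ (isSemialgebraic_box 2) hsub)) := by
      abel
    show of (B.restrict _ (isSemialgebraic_box 2) hsub) - of β ∈ relations
    rw [hsum]
    exact relations.sub_mem h1 h2
  exact hrρ.trans hρβ

end Summit.KontsevichZagierPeriods.KontsevichZagierPeriods.CompleteModGammaSectorCuspLine
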